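import Summits.ValiantsHypothesis.ValiantsHypothesis.Theorems.GrenetZeonDualUnipotentThreeHalvesHeavyTopThmCTraceKit

/-!
# `GrenetZeon.DualUnipotentThreeHalves` (stmt-ValiantsHypothesis-24318), R2 heavy-top instrument — UNIFORM THEOREM C, FILE 2:
# three facts of linear algebra in `ℂ^N` and the «at most one deficient height» count

Experiment cell «val-heavytop-census» (D-0160), engine seat val-htc-eng-1 g5.  Size-free lemmas for the uniform kernel port of THEOREM C
(val-idea-30 MEMO codim-one rev 1.2):

* `exists_vec_of_finrank_succ` — a subspace of `ℂ^N` of dimension `N − 1` is `{x : u ⬝ x = 0}` for some `u ≠ 0`;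
* `exists_smul_of_forall_dot` — if `v ⬝ x = 0` whenever `u ⬝ x = 0`, then `v = t • u`;
* `exists_ne_zero_of_two_le_finrank` — a subspace of dimension `≥ 2` meets every coordinate hyperplane `{c : c i = 0}` non-trivially;
* ★ `exists_deficient_height` — the COUNT: if `P h + N h ≤ n − h` for all `h`, with `+ 1` whenever `bad h`, and
  `Σ_{h=1}^{n−1} (P h + N h) ≥ C(n,2) − 1`, then there is ONE height `h⋆` off which `P h + N h = n − h` and `¬ bad h`, and everywhere
  `P h + N h + 1 ≥ n − h` (the memo's «CASE 1 / CASE 2 with zero slack»; ✓ `…ThmC6`'s `key`, made uniform in `n`).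

Honest framing: infrastructure; nothing here proves or refutes `HeavyTopLaw`/`HeavyTopSlowLaw`, 24318, S3 or 8062; `VP ≠ VNP` is NOT proved.
No definitions.  [folklore; this seat]
-/

noncomputable section

-- single-conjunct layout: Sub = Summit, duplicated namespace component intended
set_option linter.dupNamespace false

namespace Summit.ValiantsHypothesis.ValiantsHypothesis.Theorems.GrenetZeon.HeavyTopThmCLinAlg

open Matrix

/-! ## Hyperplanes of `ℂ^N` -/

/-- A linear functional on `ℂ^N` is a dot product. [folklore] -/
theorem exists_vec_of_functional {N : ℕ} (f : (Fin N → ℂ) →ₗ[ℂ] ℂ) : ∃ u : Fin N → ℂ, ∀ x, f x = u ⬝ᵥ x := by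
  classical
  refine ⟨fun i => f (Pi.single i 1), fun x => ?_⟩
  rw [LinearMap.pi_apply_eq_sum_univ f x, dotProduct]
  refine Finset.sum_congr rfl fun i _ => ?_
  rw [smul_eq_mul, mul_comm]
  congr 2
  funext j
  rw [Pi.single_apply]
  simp only [@eq_comm _ j i]

/-- ★ A subspace of `ℂ^N` of dimension `N − 1` is a coordinate-free hyperplane `{x : u ⬝ x = 0}`, `u ≠ 0`. [folklore] -/
theorem exists_vec_of_finrank_succ {N : ℕ} (P : Submodule ℂ (Fin N → ℂ)) (hP : Module.finrank ℂ P + 1 = N) :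
    ∃ u : Fin N → ℂ, u ≠ 0 ∧ ∀ x, x ∈ P ↔ u ⬝ᵥ x = 0 := by
  classical
  have hlt : P < ⊤ := by
    refine lt_of_le_of_ne le_top fun h => ?_
    have := finrank_top ℂ (Fin N → ℂ)
    rw [← h, Module.finrank_fin_fun] at this
    omega
  obtain ⟨f, hf0, hPf⟩ := Submodule.exists_le_ker_of_lt_top P hlt
  obtain ⟨u, hu⟩ := exists_vec_of_functional f
  have hu0 : u ≠ 0 := by
    intro h
    apply hf0
    ext x
    · rw [LinearMap.comp_apply, hu, h, zero_dotProduct]; rfl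
  refine ⟨u, hu0, fun x => ?_⟩
  -- `P = ker f` by dimension
  have hker : Module.finrank ℂ (LinearMap.ker f) + 1 = N := by
    have hrange : Module.finrank ℂ (LinearMap.range f) = 1 := by
      refine le_antisymm ((Submodule.finrank_le _).trans (by rw [Module.finrank_self])) ?_
      refine Nat.one_le_iff_ne_zero.2 fun h0 => hf0 ?_
      exact LinearMap.range_eq_bot.1 (Submodule.finrank_eq_zero.1 h0)
    have h1 := LinearMap.finrank_range_add_finrank_ker f
    rw [hrange, Module.finrank_fin_fun] at h1
    omega
  have hPeq : P = LinearMap.ker f :=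
    Submodule.eq_of_le_of_finrank_eq hPf (by omega)
  rw [hPeq, LinearMap.mem_ker, hu]

/-- ★ If `v ⬝ x = 0` for every `x` with `u ⬝ x = 0`, then `v` is a multiple of `u`. [folklore] -/
theorem exists_smul_of_forall_dot {N : ℕ} (u v : Fin N → ℂ) (h : ∀ x : Fin N → ℂ, u ⬝ᵥ x = 0 → v ⬝ᵥ x = 0) :
    ∃ t : ℂ, v = t • u := by
  classical
  by_cases hu : u = 0
  · refine ⟨0, ?_⟩
    rw [zero_smul]
    funext i
    have := h (Pi.single i 1) (by rw [hu, zero_dotProduct])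
    rwa [dotProduct_single, mul_one] at this
  · obtain ⟨i₀, hi₀⟩ : ∃ i₀, u i₀ ≠ 0 := by
      by_contra hall
      push Not at hall
      exact hu (funext hall)
    refine ⟨v i₀ / u i₀, funext fun j => ?_⟩
    -- test vector `u_{i₀} e_j − u_j e_{i₀}`
    have ht := h (u i₀ • Pi.single j 1 - u j • Pi.single i₀ 1) (by
      rw [dotProduct_sub, dotProduct_smul, dotProduct_smul, dotProduct_single, dotProduct_single, mul_one, mul_one,
        smul_eq_mul, smul_eq_mul]; ring)
    rw [dotProduct_sub, dotProduct_smul, dotProduct_smul, dotProduct_single, dotProduct_single, mul_one, mul_one,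
      smul_eq_mul, smul_eq_mul] at ht
    rw [Pi.smul_apply, smul_eq_mul]
    field_simp
    linear_combination ht

/-- ★ A subspace of dimension `≥ 2` contains a non-zero vector with prescribed vanishing coordinate. [folklore] -/
theorem exists_ne_zero_of_two_le_finrank {N : ℕ} (L : Submodule ℂ (Fin N → ℂ)) (hL : 2 ≤ Module.finrank ℂ L) (i : Fin N) :
    ∃ c ∈ L, c ≠ 0 ∧ c i = 0 := by
  classical
  let f : L →ₗ[ℂ] ℂ := (LinearMap.proj i : (Fin N → ℂ) →ₗ[ℂ] ℂ) ∘ₗ L.subtype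
  have h1 := LinearMap.finrank_range_add_finrank_ker f
  have h2 : Module.finrank ℂ (LinearMap.range f) ≤ 1 := by
    have := Submodule.finrank_le (LinearMap.range f)
    rwa [Module.finrank_self] at this
  have h3 : 0 < Module.finrank ℂ (LinearMap.ker f) := by omega
  have hne : LinearMap.ker f ≠ ⊥ := fun h => by rw [h, finrank_bot] at h3; exact lt_irrefl _ h3
  obtain ⟨⟨c, hcL⟩, hck, hc0⟩ := Submodule.exists_mem_ne_zero_of_ne_bot hne
  refine ⟨c, hcL, fun h => hc0 (Subtype.ext h), ?_⟩
  rw [LinearMap.mem_ker] at hck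
  exact hck

/-! ## The count: at most one deficient height -/

/-- `Σ_{h<n−1} (n − (h+1)) = C(n,2)`. [folklore] -/
theorem sum_range_sub_succ_eq_choose (n : ℕ) : ∑ h ∈ Finset.range (n - 1), (n - (h + 1)) = n.choose 2 := by
  induction n with
  | zero => simp
  | succ m ih =>
    rcases Nat.eq_zero_or_pos m with rfl | hm
    · simp
    · obtain ⟨k, rfl⟩ : ∃ k, m = k + 1 := ⟨m - 1, by omega⟩
      rw [show k + 1 + 1 - 1 = k + 1 from by omega, Finset.sum_range_succ', Nat.choose_succ_succ, Nat.choose_one_right, ← ih,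
        show k + 1 - 1 = k from by omega]
      have : ∑ h ∈ Finset.range k, (k + 1 + 1 - (h + 1 + 1)) = ∑ h ∈ Finset.range k, (k + 1 - (h + 1)) :=
        Finset.sum_congr rfl fun h _ => by omega
      rw [this]
      omega

/-- ★ **At most one deficient height.**  Let `P h + N h ≤ n − h` for `1 ≤ h ≤ n − 1`, with `P h + N h + 1 ≤ n − h` whenever `bad h`, and
`C(n,2) ≤ Σ_{h=1}^{n−1} (P h + N h) + 1`.  Then for some `h⋆`: every `h ≠ h⋆` has `P h + N h = n − h` and `¬ bad h`; and every `h` has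
`P h + N h + 1 ≥ n − h`.  [memo §1 slack count; ✓ `…ThmC6` `key` for `n = 6`; this seat (uniform)] -/
theorem exists_deficient_height (n : ℕ) (P N : ℕ → ℕ) (bad : ℕ → Prop)
    (hb : ∀ h, 1 ≤ h → h ≤ n - 1 → P h + N h ≤ n - h)
    (hb' : ∀ h, 1 ≤ h → h ≤ n - 1 → bad h → P h + N h + 1 ≤ n - h)
    (hcount : n.choose 2 ≤ (∑ h ∈ Finset.range (n - 1), (P (h + 1) + N (h + 1))) + 1) :
    ∃ hstar : ℕ, (∀ h, 1 ≤ h → h ≤ n - 1 → h ≠ hstar → P h + N h = n - h ∧ ¬ bad h) ∧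
      (∀ h, 1 ≤ h → h ≤ n - 1 → n - h ≤ P h + N h + 1) := by
  classical
  -- the slacks `δ (j+1) = n − (j+1) − (P + N)` sum to at most `1`
  have hsum : ∑ j ∈ Finset.range (n - 1), (P (j + 1) + N (j + 1) + (n - (j + 1) - (P (j + 1) + N (j + 1)))) = n.choose 2 := by
    rw [← sum_range_sub_succ_eq_choose]
    refine Finset.sum_congr rfl fun j hj => ?_
    rw [Finset.mem_range] at hj
    have := hb (j + 1) (by omega) (by omega)
    omega
  rw [Finset.sum_add_distrib] at hsum
  have hδ : ∑ j ∈ Finset.range (n - 1), (n - (j + 1) - (P (j + 1) + N (j + 1))) ≤ 1 := by omega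
  have single : ∀ h, 1 ≤ h → h ≤ n - 1 → n - h - (P h + N h) ≤ 1 := by
    intro h h1 h2
    have hmem : h - 1 ∈ Finset.range (n - 1) := Finset.mem_range.2 (by omega)
    have hle := Finset.single_le_sum (f := fun j => n - (j + 1) - (P (j + 1) + N (j + 1))) (fun j _ => Nat.zero_le _) hmem
    simp only [show h - 1 + 1 = h from by omega] at hle
    omega
  have hB : ∀ h, 1 ≤ h → h ≤ n - 1 → n - h ≤ P h + N h + 1 := fun h h1 h2 => by have := single h h1 h2; omega
  by_cases hex : ∃ h₀, 1 ≤ h₀ ∧ h₀ ≤ n - 1 ∧ P h₀ + N h₀ < n - h₀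
  · obtain ⟨h₀, h01, h02, h0lt⟩ := hex
    refine ⟨h₀, fun h h1 h2 hne => ?_, hB⟩
    have hzero : P h + N h = n - h := by
      by_contra hne'
      have hlt : P h + N h < n - h := lt_of_le_of_ne (hb h h1 h2) hne'
      -- two positive slacks contradict `Σ δ ≤ 1`
      have hsub : ({h₀ - 1, h - 1} : Finset ℕ) ⊆ Finset.range (n - 1) := by
        intro j hj
        rw [Finset.mem_insert, Finset.mem_singleton] at hj
        rw [Finset.mem_range]; omega
      have hle := Finset.sum_le_sum_of_subset (f := fun j => n - (j + 1) - (P (j + 1) + N (j + 1))) hsub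
      rw [Finset.sum_pair (by omega)] at hle
      simp only [show h₀ - 1 + 1 = h₀ from by omega, show h - 1 + 1 = h from by omega] at hle
      omega
    refine ⟨hzero, fun hbad => ?_⟩
    have := hb' h h1 h2 hbad
    omega
  · push Not at hex
    refine ⟨0, fun h h1 h2 _ => ?_, hB⟩
    have hzero : P h + N h = n - h := le_antisymm (hb h h1 h2) (hex h h1 h2)
    refine ⟨hzero, fun hbad => ?_⟩
    have := hb' h h1 h2 hbad
    omega

end Summit.ValiantsHypothesis.ValiantsHypothesis.Theorems.GrenetZeon.HeavyTopThmCLinAlg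

end
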